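import Literature.NumberTheory.LFunctions.DedekindZeta1LogFreeLemmaA
import Literature.NumberTheory.LFunctions.ClassGroupLogFreeLemmaB
import HarnessLib

/-!
# Bombieri's Lemme B for `ζ₁_K(s) = (s − 1) ζ_K(s)` (degree `≤ 2`), uniformly in the field

Topic `Literature/NumberTheory/LFunctions`, namespace `Literature.NumberTheory.LFunctions.NumberField`.
Everything here is PROVED (theorems only; no named facts).

The `χ = 1` member of the family of `ClassGroupLogFreeLemmaB`: with `Λ_1 = Λ_K`
(`twistVonMangoldt_classGroupCharIdealHom_one`) and the same normalised coefficients
`b_n = Λ_K(n) n^{−1−iv}/n_K = coefB K 1 v n`,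

  `(ζ₁_K'/ζ₁_K)^{(k)}(s₀) = (−1)^k k!/(s₀ − 1)^{k+1} + (−1)^{k+1} k! r^{−k} n_K Σ_n b_n p_k(r log n)`

(`iteratedDeriv_logDeriv_dedekindZeta₁_eq`).  Away from the pole in height, `|v| ≥ 4e^{10} r`, the pole
term is at most half the lower bound of Lemme A, so Lemme A for `ζ₁_K` (`lemmeA_dedekindZeta₁`) gives
`e^{−10K'} 2^{−(k+1)}/r ≤ 2 n_K ‖Σ_n b_n p_k(r log n)‖` (`exists_norm_tsum_gTermB_ge_dedekindZeta₁`), and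
the abstract Lemme B (slack `η = 2n_K ≤ 4`, so `n_K ≤ 2`) yields

* `lemmeB_dedekindZeta₁` — for `n_K ≤ 2`, `ℒ'_v ≤ L'`, `0 < r ≤ r₀`, `rL' ≥ 1`, `4e^{10} r ≤ |v|`, a zero of
  `ζ_K` within `r` of `1 + iv`, `log x ≥ A₀ L'`, `z ≤ x^{a₀/2}`:
  `e^{−10}/(2n_K)² · x^{−r/10}/r³ ≤ ∫_{⌊x^{a₀}⌋}^{x} ‖Σ_{⌊x^{a₀}⌋ < n ≤ t, n ∈ G_z} b_n‖² dt/t`.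

The zeros of `ζ_K` with `|γ| < 4e^{10} r` (near the pole) are counted directly by the Lemme de densité
in the assembly of Théorème 14.

## References

* [Bombieri1987GrandCrible] E. Bombieri, Astérisque 18 (1987), §6 Lemme B (the case of `ζ`).
* [ThornerZaman2017] J. Thorner, A. Zaman, Algebra Number Theory 11 (2017), Lemma 5.4 (`δ(χ)𝟙_{|τ|<Ar}`).
-/

noncomputable section

open Complex Metric Set Filter Finset
open scoped Real Topology LSeries.notation ArithmeticFunction.vonMangoldt

namespace Literature.NumberTheory.LFunctions.NumberField

open Literature.NumberTheory.LFunctions.LogFreeLocal Literature.NumberTheory.LFunctions.LogFreeDensity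
open scoped nonZeroDivisors _root_.NumberField

variable {K : Type*} [Field K] [NumberField K]

/-! ### `Λ_1 = Λ_K` and the derivative formula with the pole -/

/-- `Λ_χ` for the trivial class group character is `Λ_K`. [folklore] -/
theorem twistVonMangoldt_classGroupCharIdealHom_one :
    twistVonMangoldt K (classGroupCharIdealHom (1 : ClassGroup (𝓞 K) →* ℂˣ)) = fun n ↦ (vonMangoldtNorm K n : ℂ) := by
  funext n
  rw [classGroupCharIdealHom_one, twistVonMangoldt_trivialChar]

/-- For `Re s > 1`: `ζ₁_K'/ζ₁_K` agrees near `s` with `z ↦ Σ_{ρ ∈ {1}} 1/(z − ρ) + (−L(Λ_1, z))`. [folklore] -/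
theorem logDeriv_dedekindZeta₁_eventuallyEq {s : ℂ} (hs : 1 < s.re) :
    logDeriv (dedekindZeta₁ K) =ᶠ[𝓝 s]
      ((fun z => ∑ ρ ∈ ({1} : Finset ℂ), (1 : ℂ) / (z - ρ)) +
        fun z => -LSeries (twistVonMangoldt K (classGroupCharIdealHom (1 : ClassGroup (𝓞 K) →* ℂˣ))) z) := by
  have hopen : IsOpen {z : ℂ | 1 < z.re} := isOpen_lt continuous_const Complex.continuous_re
  filter_upwards [hopen.mem_nhds hs] with z hz
  rw [Pi.add_apply, logDeriv_dedekindZeta₁_eq hz, sum_singleton, twistVonMangoldt_classGroupCharIdealHom_one]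
  ring

/-- **`(ζ₁_K'/ζ₁_K)^{(k)}(s) = (−1)^{k+1} L(log^k Λ_1, s) + (−1)^k k!/(s − 1)^{k+1}`** for `Re s > 1`.
[cite: Bombieri1987GrandCrible, §6 Lemme B (proof)] -/
theorem iteratedDeriv_logDeriv_dedekindZeta₁_eq {s : ℂ} (hs : 1 < s.re) (k : ℕ) :
    iteratedDeriv k (logDeriv (dedekindZeta₁ K)) s =
      (-1) ^ (k + 1) * LSeries (LSeries.logMul^[k] (twistVonMangoldt K (classGroupCharIdealHom (1 : ClassGroup (𝓞 K) →* ℂˣ)))) s +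
        (-1) ^ k * k.factorial * (1 / (s - 1) ^ (k + 1)) := by
  set a := twistVonMangoldt K (classGroupCharIdealHom (1 : ClassGroup (𝓞 K) →* ℂˣ)) with ha
  have hs1 : s ∉ ({1} : Finset ℂ) := by
    rw [Finset.mem_singleton]; intro h; rw [h, one_re] at hs; exact lt_irrefl _ hs
  have habs : LSeries.abscissaOfAbsConv a < s.re :=
    lt_of_le_of_lt (abscissaOfAbsConv_twistVonMangoldt_classGroup_le 1) (by exact_mod_cast hs)
  have hcd1 : ContDiffAt ℂ k (fun z => -LSeries a z) s :=
    ((LSeries_analyticOnNhd a s habs).contDiffAt).neg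
  have hcd2 : ContDiffAt ℂ k (fun z : ℂ => ∑ ρ ∈ ({1} : Finset ℂ), (1 : ℂ) / (z - ρ)) s := by
    refine ContDiffAt.sum fun ρ hρ => ?_
    exact contDiffAt_const.div (contDiffAt_id.sub contDiffAt_const)
      (sub_ne_zero.2 fun h => hs1 (h ▸ hρ))
  rw [(logDeriv_dedekindZeta₁_eventuallyEq hs).iteratedDeriv_eq, iteratedDeriv_add hcd2 hcd1,
    iteratedDeriv_fun_neg, LSeries_iteratedDeriv k habs,
    iteratedDeriv_sum_div_sub {1} (fun _ => (1 : ℂ)) k hs1, sum_singleton]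
  ring

/-- **The norm form**: `‖(ζ₁_K'/ζ₁_K)^{(k)}(s₀)‖ ≤ k! r^{−k} n_K ‖Σ_n b_n p_k(r log n)‖ + k!/‖s₀ − 1‖^{k+1}`,
`s₀ = 1 + r + iv`, `b = coefB K 1 v`. [folklore] -/
theorem norm_iteratedDeriv_logDeriv_dedekindZeta₁_le (v : ℝ) {r : ℝ} (hr : 0 < r) (k : ℕ) :
    ‖iteratedDeriv k (logDeriv (dedekindZeta₁ K)) (((1 + r : ℝ) : ℂ) + (v : ℂ) * I)‖ ≤
      k.factorial * r⁻¹ ^ k * Module.finrank ℚ K * ‖∑' n, gTermB (coefB K 1 v) r k n‖ +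
        k.factorial / ‖(((1 + r : ℝ) : ℂ) + (v : ℂ) * I) - 1‖ ^ (k + 1) := by
  have hs₀re : 1 < (((1 + r : ℝ) : ℂ) + (v : ℂ) * I).re := by simp; linarith
  rw [iteratedDeriv_logDeriv_dedekindZeta₁_eq hs₀re k]
  refine (norm_add_le _ _).trans (add_le_add ?_ (le_of_eq ?_))
  · rw [norm_mul, norm_pow, norm_neg, norm_one, one_pow, one_mul, LSeries]
    have htsum : ∑' n, LSeries.term (LSeries.logMul^[k] (twistVonMangoldt K (classGroupCharIdealHom (1 : ClassGroup (𝓞 K) →* ℂˣ))))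
        (((1 + r : ℝ) : ℂ) + (v : ℂ) * I) n =
        (k.factorial : ℂ) * (r⁻¹ : ℂ) ^ k * (Module.finrank ℚ K : ℂ) * ∑' n, gTermB (coefB K 1 v) r k n := by
      rw [← tsum_mul_left]
      exact tsum_congr fun n => term_logMul_eq_coefB 1 v hr k n
    rw [htsum, norm_mul, norm_mul, norm_mul, Complex.norm_natCast, norm_pow, norm_inv, Complex.norm_real,
      Real.norm_eq_abs, abs_of_pos hr, Complex.norm_natCast]
  · rw [norm_mul, norm_mul, norm_pow, norm_neg, norm_one, one_pow, one_mul, Complex.norm_natCast, norm_div,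
      norm_one, norm_pow, one_div, div_eq_mul_inv]

/-! ### Lemme A on the series side (away from the pole) and Lemme B -/

/-- **Lemme A on the series side for `ζ₁_K`, away from the pole** (`|v| ≥ 4e^{10} r`): with the constant
`c₄` of `lemmeA_dedekindZeta₁`, for `K' ≥ c₄ rL' + 2` there is `k ∈ [K', 2K']` with
`e^{−10K'} 2^{−(k+1)}/r ≤ 2 n_K ‖Σ_n b_n p_k(r log n)‖`. [cite: Bombieri1987GrandCrible, §6 Lemme B (proof)] -/
theorem exists_norm_tsum_gTermB_ge_dedekindZeta₁ :
    ∃ c₄ : ℝ, 0 < c₄ ∧ ∀ (K : Type*) [Field K] [NumberField K],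
      ∀ (v r L' : ℝ), lemmaAHeight K v ≤ L' → 0 < r → 512 * r ≤ 1 / 8 → 1 ≤ r * L' →
        4 * Real.exp 10 * r ≤ |v| →
        (∃ ρ₀ : ℂ, dedekindZeta₁ K ρ₀ = 0 ∧ ‖ρ₀ - (1 + (v : ℂ) * I)‖ ≤ r) →
        ∀ K' : ℕ, c₄ * (r * L') + 2 ≤ K' →
          ∃ k ∈ Finset.Icc K' (2 * K'),
            Real.exp (-(10 * K')) * (2⁻¹ ^ (k + 1) / r) ≤
              2 * Module.finrank ℚ K * ‖∑' n, gTermB (coefB K 1 v) r k n‖ := by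
  obtain ⟨c₄, h₄, hA⟩ := lemmeA_dedekindZeta₁
  refine ⟨c₄, h₄, fun K _ _ v r L' hL hr hr8 hu hv hzero K' hK' => ?_⟩
  obtain ⟨k, hk, hbound⟩ := hA K v r L' hL hr hr8 hu hzero K' hK'
  refine ⟨k, hk, ?_⟩
  rw [Finset.mem_Icc] at hk
  set s₀ : ℂ := ((1 + r : ℝ) : ℂ) + (v : ℂ) * I with hs₀
  set N : ℝ := ‖∑' n, gTermB (coefB K 1 v) r k n‖ with hN
  have hnK : (0 : ℝ) < Module.finrank ℚ K := by exact_mod_cast Module.finrank_pos (R := ℚ) (M := K)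
  have hfacpos : (0 : ℝ) < k.factorial := by positivity
  have h1 := hbound.trans (div_le_div_of_nonneg_right (norm_iteratedDeriv_logDeriv_dedekindZeta₁_le (K := K) v hr k) hfacpos.le)
  have hsimp : ((k.factorial : ℝ) * r⁻¹ ^ k * Module.finrank ℚ K * N + k.factorial / ‖s₀ - 1‖ ^ (k + 1)) / k.factorial =
      r⁻¹ ^ k * (Module.finrank ℚ K * N) + (‖s₀ - 1‖ ^ (k + 1))⁻¹ := by
    field_simp
  rw [hsimp] at h1
  -- the pole term: `|s₀ − 1| ≥ |v| ≥ 4 e^{10} r`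
  have hvs : 4 * Real.exp 10 * r ≤ ‖s₀ - 1‖ := by
    have him : (s₀ - 1).im = v := by simp [hs₀]
    calc 4 * Real.exp 10 * r ≤ |v| := hv
      _ = |(s₀ - 1).im| := by rw [him]
      _ ≤ ‖s₀ - 1‖ := Complex.abs_im_le_norm _
  have hs₀1pos : 0 < ‖s₀ - 1‖ := lt_of_lt_of_le (by positivity) hvs
  have hpole : (‖s₀ - 1‖ ^ (k + 1))⁻¹ ≤ Real.exp (-(10 * K')) * (2 * r)⁻¹ ^ (k + 1) / 2 := by
    -- `(2r/|s₀−1|)^{k+1} ≤ (e^{-10}/2)^{k+1} ≤ e^{-10K'}/2`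
    have hratio : 2 * r / ‖s₀ - 1‖ ≤ Real.exp (-10) / 2 := by
      rw [div_le_div_iff₀ hs₀1pos two_pos]
      have h1 : Real.exp (-10) * ‖s₀ - 1‖ ≥ Real.exp (-10) * (4 * Real.exp 10 * r) :=
        mul_le_mul_of_nonneg_left hvs (Real.exp_pos _).le
      have he : Real.exp (-10) * Real.exp 10 = 1 := by rw [← Real.exp_add]; norm_num
      have h2 : Real.exp (-10) * (4 * Real.exp 10 * r) = 4 * r := by
        rw [show Real.exp (-10) * (4 * Real.exp 10 * r) = 4 * r * (Real.exp (-10) * Real.exp 10) by ring, he, mul_one]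
      linarith
    have hratio0 : 0 ≤ 2 * r / ‖s₀ - 1‖ := by positivity
    have hpow : (2 * r / ‖s₀ - 1‖) ^ (k + 1) ≤ (Real.exp (-10) / 2) ^ (k + 1) :=
      pow_le_pow_left₀ hratio0 hratio _
    have hek : (Real.exp (-10) / 2) ^ (k + 1) ≤ Real.exp (-(10 * K')) / 2 := by
      rw [div_pow]
      have h2k : (2 : ℝ) ≤ 2 ^ (k + 1) := by
        calc (2 : ℝ) = 2 ^ 1 := (pow_one _).symm
          _ ≤ 2 ^ (k + 1) := pow_le_pow_right₀ (by norm_num) (by omega)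
      have hkr : (K' : ℝ) ≤ k := by exact_mod_cast hk.1
      have hexp : Real.exp (-10) ^ (k + 1) ≤ Real.exp (-(10 * K')) := by
        rw [← Real.exp_nat_mul]
        exact Real.exp_le_exp.mpr (by push_cast; nlinarith only [hkr])
      exact div_le_div₀ (Real.exp_pos _).le hexp two_pos h2k
    have heq : (‖s₀ - 1‖ ^ (k + 1))⁻¹ = (2 * r / ‖s₀ - 1‖) ^ (k + 1) * (2 * r)⁻¹ ^ (k + 1) := by
      rw [← mul_pow, ← inv_pow]; congr 1; field_simp
    rw [heq]
    calc (2 * r / ‖s₀ - 1‖) ^ (k + 1) * (2 * r)⁻¹ ^ (k + 1) ≤ (Real.exp (-(10 * K')) / 2) * (2 * r)⁻¹ ^ (k + 1) :=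
          mul_le_mul_of_nonneg_right (hpow.trans hek) (by positivity)
      _ = _ := by ring
  -- assemble
  have hkey : Real.exp (-(10 * K')) * (2 * r)⁻¹ ^ (k + 1) / 2 ≤ r⁻¹ ^ k * (Module.finrank ℚ K * N) := by linarith
  have key : Real.exp (-(10 * K')) * (2⁻¹ ^ (k + 1) / r) = r ^ k * (Real.exp (-(10 * K')) * (2 * r)⁻¹ ^ (k + 1)) := by
    rw [mul_inv, mul_pow, pow_succ r⁻¹ k, inv_pow, inv_pow]
    field_simp
  rw [key]
  calc r ^ k * (Real.exp (-(10 * K')) * (2 * r)⁻¹ ^ (k + 1)) = 2 * (r ^ k * (Real.exp (-(10 * K')) * (2 * r)⁻¹ ^ (k + 1) / 2)) := by ring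
    _ ≤ 2 * (r ^ k * (r⁻¹ ^ k * (Module.finrank ℚ K * N))) := by
        refine mul_le_mul_of_nonneg_left (mul_le_mul_of_nonneg_left hkey (by positivity)) (by norm_num)
    _ = 2 * Module.finrank ℚ K * N := by
        rw [← mul_assoc (r ^ k), ← mul_pow, mul_inv_cancel₀ hr.ne', one_pow, one_mul]; ring

/-- **Bombieri's Lemme B for `ζ₁_K`, degree `n_K ≤ 2`, away from the pole** (uniformly in the field):
there are absolute `A₀, r₀ > 0` such that for `ℒ'_v ≤ L'`, `0 < r ≤ r₀`, `rL' ≥ 1`, `4e^{10} r ≤ |v|`,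
a zero `ρ₀` of `ζ_K` with `|ρ₀ − (1 + iv)| ≤ r`, `0 < x`, `log x ≥ A₀ L'` and `z ≤ x^{a₀/2}`,
`e^{−10}/(2n_K)² · x^{−r/10}/r³ ≤ ∫_{⌊x^{a₀}⌋}^{x} ‖Σ_{⌊x^{a₀}⌋ < n ≤ t, n = p^m, p > z} b_n‖² dt/t`.
[cite: Bombieri1987GrandCrible, §6 Lemme B] -/
theorem lemmeB_dedekindZeta₁ :
    ∃ A₀ r₀ : ℝ, 0 < A₀ ∧ 0 < r₀ ∧
      ∀ (K : Type*) [Field K] [NumberField K], Module.finrank ℚ K ≤ 2 →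
      ∀ (v r L' x : ℝ) (z : ℕ), lemmaAHeight K v ≤ L' → 0 < r → r ≤ r₀ → 1 ≤ r * L' →
        4 * Real.exp 10 * r ≤ |v| →
        (∃ ρ₀ : ℂ, dedekindZeta₁ K ρ₀ = 0 ∧ ‖ρ₀ - (1 + (v : ℂ) * I)‖ ≤ r) →
        0 < x → A₀ * L' ≤ Real.log x → (z : ℝ) ≤ x ^ (expoB / 2) →
          Real.exp (-10) / (2 * (Module.finrank ℚ K : ℝ)) ^ 2 * x ^ (-(r / 10)) / r ^ 3 ≤
            ∫ t in Set.Ioc (⌊x ^ expoB⌋₊ : ℝ) x, ‖summatory (coefSiftedB (coefB K 1 v) x z) t‖ ^ 2 / t := by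
  obtain ⟨c₄, hc₄, hA⟩ := exists_norm_tsum_gTermB_ge_dedekindZeta₁
  set θ : ℝ := Real.exp 14 with hθ
  have hθ1 : 1 ≤ θ := Real.one_le_exp (by norm_num)
  refine ⟨240 * (c₄ + 8 * θ + 8), 1 / (112 * θ), by positivity, by positivity,
    fun K _ _ hnK v r L' x z hL hr hr0 hu hv hzero hx hlogx hz => ?_⟩
  have hL'1 : 1 ≤ L' := (one_le_lemmaAHeight v).trans hL
  set u : ℝ := r * L' with hudef
  have hr1 : r ≤ 1 := by
    have : 1 / (112 * θ) ≤ 1 := by rw [div_le_one (by positivity)]; nlinarith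
    linarith
  have hr8 : 512 * r ≤ 1 / 8 := by
    have h := hr0
    rw [le_div_iff₀ (by positivity)] at h
    have h14 : (4096 : ℝ) ≤ θ := by
      have := pow_le_exp_mul (c := 4096) (m := 14) (by norm_num) (by norm_num) 1
      simpa [hθ] using this
    nlinarith
  set Lx : ℝ := Real.log x with hLx
  have hA₀pos : 0 < 240 * (c₄ + 8 * θ + 8) := by positivity
  have hLxpos : 0 < Lx := lt_of_lt_of_le (by positivity) hlogx
  have hrLx : 240 * (c₄ + 8 * θ + 8) * u ≤ r * Lx := by
    rw [hudef]
    have := mul_le_mul_of_nonneg_left hlogx hr.le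
    linarith
  set K' : ℕ := ⌊r * Lx / 240⌋₊ with hKdef
  have hK1 : (K' : ℝ) ≤ r * Lx / 240 := Nat.floor_le (by positivity)
  have hKlow : (c₄ + 8 * θ + 8) * u - 1 ≤ K' := by
    have hK2 : r * Lx / 240 < K' + 1 := Nat.lt_floor_add_one _
    have : (c₄ + 8 * θ + 8) * u ≤ r * Lx / 240 := by
      rw [le_div_iff₀ (by norm_num)]; linarith
    linarith
  have hu1 : (1 : ℝ) ≤ u := hu
  have hprod1 : 0 ≤ (8 * θ + 8) * (u - 1) := mul_nonneg (by positivity) (by linarith only [hu1])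
  have hprod2 : 0 ≤ c₄ * u := mul_nonneg hc₄.le (by linarith only [hu1])
  have hKc : c₄ * (r * L') + 2 ≤ K' := by
    rw [← hudef]
    nlinarith only [hKlow, hprod1, hθ1, hu1]
  have hK8r : (8 : ℝ) ≤ K' := by
    nlinarith only [hKlow, hprod1, hprod2, hθ1, hu1]
  have hK8 : 8 ≤ K' := by exact_mod_cast hK8r
  have hKθ : 8 * θ * u ≤ K' := by
    nlinarith only [hKlow, hprod2, hu1]
  obtain ⟨k, hk, hmain⟩ := hA K v r L' hL hr hr8 hu hv hzero K' hKc
  have hη1 : (1 : ℝ) ≤ 2 * (Module.finrank ℚ K : ℝ) := by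
    have : (1 : ℝ) ≤ Module.finrank ℚ K := by exact_mod_cast Module.finrank_pos (R := ℚ) (M := K)
    linarith
  have hη4 : 2 * (Module.finrank ℚ K : ℝ) ≤ 4 := by
    have : (Module.finrank ℚ K : ℝ) ≤ 2 := by exact_mod_cast hnK
    linarith
  exact lemmeB_core_abstract (norm_coefB_le 1 v) (fun n hn ↦ coefB_eq_zero_of_not_isPrimePow 1 v hn)
    hr hr0 hu hx hη1 hη4 hK8 hKθ hk (summable_gTermB_coefB 1 v hr k) hmain hz

end Literature.NumberTheory.LFunctions.NumberField

end
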